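import Summits.QuantumFields.BalabanUV.T4Continuum.Spine.NE1p.DressedSmallFieldFamilyCount
import Summits.QuantumFields.BalabanUV.T4Continuum.Spine.NE1p.DressedSmallFieldDepCoresWitnessLive

/-!
# T⁴ programme, spine estimate NE1′ (node O3b/H2) — WITNESS «N0s §4's FAMILIES END FIRES — THE 𝐃-SUM OF (2.29) IS INDEXED IN
# KERNEL»: the owner's `attachedPart_locE_le_of_coresAt_pencil_families` (`Spine/NE1p/DressedSmallFieldFamilyCount`, N0s) APPLIED ONCE
# BY NAME — its first DECIDED applier — on a toy whose term index IS the set of covering families of the torus catalogue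

Cell `pub-balaban`, sub-cell `t4`, row NE1′ formalisation crew (`t4/formal/NE1p/LEAVES.md` row W45 ∕ DAG N29zzg; INTENT HOME/CLAIMS.log l.18676,
BOOKED typer R-T124 (iv) l.18869; X151 its read), unit `b2b-balaban-t4-ne1p-formalise-leaf-10` (gen 10).  ADDITIVE — imports the owner's N0s `Spine/NE1p/DressedSmallFieldFamilyCount`
(t4-ne1p-p1 g29; → N0r → N0q → N0p; b13's `Literature/…/B13FamilySum` in its cone) and W41 `Spine/NE1p/DressedSmallFieldDepCoresWitnessLive`
(leaf-09 g11; → W41.1 → W35 `DressedSmallFieldCoresMassWitness` → W33 `DressedSmallFieldCoresWitness` → W24 `DressedSmallFieldTorusWitness`,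
row NE5's `Support/B13HistWitness`) ONLY; toy DATA `def`s + theorems; 0 `def … : Prop`, 0 cite, 0 sorry, 0 `attribute`; nothing of N0s ∕ N0r ∕
N0q ∕ N0p ∕ W24 ∕ W33 ∕ W35 ∕ W41 ∕ row NE5 ∕ b13's `B13FamilySum` ∕ pv22's torus geometry is restated — `coreW`, `liveTable`, `E1`, `crd`,
`ctr0`, `hroom0`, `Acst`, `incr`, `integral_incr_pos`, `cM`, `letterMass_coreW`, `hsmall_mu`, `budget_half`, `dj_X₀`, `termAt_coreW_pencil`,
`closedForm_real_sub_zero`, `norm_term_le`, `X₀`, `eq_X₀_iff`, `exp_locE_cube`, `hrate_torus`, `torus_consts`, `K₀_four`, `coveringFamilies`,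
`mem_coveringFamilies`, `tgeometry`, `tsys` are used BY NAME.

WHY.  N0s splits (B3)'s letter budget `hM3` into a per-term AMPLITUDE `hAmp` and a table-blind COUNT `hCount`, and in §4 takes the term
index to be `Finset Dk.Dom` — Mayer subfamilies `𝐃` of scale-`k` domains — discharging `hCount` in kernel by the (2.27)∕(2.29) step of
[Balaban1988RGII]'s resummation (b13's PROVED `B13FamilySum.ineq229_locDomainSys` on a (2.11)-geometry `Gk` one scale down).  Every
decided core family in the tree (W33∕W35 `coreFam`, W41's dependent family, row NE5's toys) is indexed by `Unit` or `Bool`; NO activity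
in the tree is indexed by covering families, and N0s §4's END has no DECIDED applier (the crew's S34 faces re-socket it with its binders
DISPLAYED).  This file gives it ONE, on the periodic carrier:
* §1 PRINT's ORDER-OF-CHOICE CLAUSES MET AT LOCATED NUMERALS OF OURS over pv22's torus constants (`torus_consts`, `K₀_four`): the rate split
  `δF := 1∕4`, `κF := 4·(64·log 162 + 1)` — so `δF·κF = κ₀ + 1` and N0s's «κ sufficiently large» clause `Gk.κ₀ + 1 ≤ δκ` holds WITH
  EQUALITY (`hκ_F`) — and `α₆F := (e·K₀(64,8)·64)⁻¹` — so the «α₆ sufficiently small» clause `e·Gk.K₀·Gk.c₁·α₆ ≤ 1` holds WITH EQUALITY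
  (`h229_F_eq`); `α₆F ≤ 1` (`α₆F_le_one`, from `K₀(64,8) ≥ 1∕81` and `e ≥ 2`);
* §2 IN KERNEL, LOCATED: **`coveringFamilies_unitCube`** — the covering families (b13's `coveringFamilies`, the index set of (2.29)) of a
  unit cube of the torus catalogue `tsys 4 N` are EXACTLY `{{X₀}}`: at a unit cube the 𝐃-sum has ONE family (a member of a covering family
  of `{0}` is a non-empty domain inside `{0}`, i.e. W24's `X₀`; the empty family covers `∅`); the term indexing of record
  `termsF Z := coveringFamilies univ Gk.cubes (Gk.cubes Z)` = ALL covering families of the footprint, so N0s's `hterms` holds WITH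
  EQUALITY (`Finset.Subset.refl`) — (2.29)'s full index set, N0s §2's `count_coveringFamilies_geometry` exercised at full strength on every
  polymer inside the END;
* §3 THE FAMILY-INDEXED CORES (toy DATA): one W33 core `coreW (cF Df) r` per family `Df` with the FAMILY-DEPENDENT weight
  `cF Df := (cM r∕2)·pF Df`, `pF Df := Π_{Y∈Df} (α₆F·e^{−δF κF d(Y)}·e^{−R(d(Y)+5)})`, `R := 2κ₀ + 2` (W24's located rate): the per-family
  amplitude IS the (2.28)-shaped product of N0s's displayed `hAmp` BY CHOICE, so `hAmp_F` holds for EVERY sub-polymer and EVERY family by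
  W41's `budget_half` (`|cM r∕2|·√(2π)·e^{r·u} ≤ A∕2`, `u ≤ 2`) at `A₀ := 0`, `A₁ := A∕4`, `ϱ := 2`; `0 < pF ≤ 1`; on `X₀` the ONE family
  `{X₀}` carries `pF {X₀} = α₆F·e^{−5R}` (`pF_singleton_X₀`, `d(X₀) = 0` by W41's `dj_X₀`); the activity of record
  `actF k s Z := Σ_{Df ∈ termsF Z} (GF k Df k).termAt 0 (0 + s • liveTable)` (`hact`∕`hscale` by `rfl`); `hsmall_F` from W35's `hsmall_mu`;
* §4 **`familiesEnd_fires`** — N0s §4's END ONCE BY NAME with `D = Dk := tsys 4 N`, `G = Gk := tgeometry 4 N`, `foot := fun Z => Z`,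
  `hmono := le_rfl` — THE SCALE-k GEOMETRY IS READ AT THE STEP's OWN SCALE ((2.36) KIND at factor `1`; the toy does NOT model the
  `L`-refinement between the scales, said plainly), W33's `ctr0`∕`hroom0`, NE5's toy letters `(mq, bq, N₀) = (1, 0, 1)` INLINE, W24's
  `hrate_torus`, the clauses of §1, `hterms` by `Finset.Subset.refl`, `hAmp_F`; conclusion LITERAL; closed form `≤ K₀(64,8)`;
* §5 GENUINE: `actF_X₀` (ONE term on `X₀`, W41's `termAt_coreW_pencil` BY NAME), `actF_real_sub_zero` (W41's `closedForm_real_sub_zero`),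
  `actF_live` (`cF > 0`, W33's `integral_incr_pos`), `norm_actF_X₀_lt_one` (W41's `norm_term_le`, `pF ≤ 1`, W24's `dressedConst_le_one`),
  **`familiesEnd_live`**: the END's bounded quantity is NOT zero (W24's `exp_locE_cube` BY NAME).

WORDING OF RECORD (crew row W45 = DAG N29zzg, typer R-T124 (iv): the holder's sentence of l.18676 + the typer's rider ADOPTED verbatim): «(B3-amp) MET
because the weights are CHOSEN as the (2.28)-shaped product — UNPRINTED for Bałaban's cores (G-ne9p2-5); (B3-count) is N0s §2's kernel count of b13's
PROVED (2.29) on pv22's torus; `foot = id` and ‘all covering families’ are OUR toy choices».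

HONEST FRAMING.  A DECIDED TOY ([folklore]; 0 sorry; 0 citations; no `def … : Prop` — the `def`s are toy DATA and three numerals).  The
cores are THEOREM-backed instances of the cell's typed FORMAT of (2.14) (`B13TermParamGaussianBi.BiCore`) over row NE5's TOY measurable frame
with NE5's DECOUPLED toy letters `N := 1`, `q := ‖v‖²` — NOT Bałaban's (2.14) terms, NOT rows NE2∕NE3's Gaussian data, NOT the substrate's
`slotsOfRecord`; `foot = id` (both scales the same torus) and `termsF = all covering families` are OUR toy choices — (B1b) (the terms of a
polymer ARE covering families of its footprint one scale down) is NOT claimed for Bałaban's densities; (B3)'s amplitude clause `hAmp` is MET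
because the weights `cF` are CHOSEN as the (2.28)-shaped product — (B3-amp) stays UNPRINTED for Bałaban's cores (GAPS G-ne9p2-5, shared with
NE9), (B3-count) is N0s §2's kernel count (b13's PROVED (2.29) on pv22's CONSTRUCTED torus geometry); `1∕4`, `4·(64·log 162 + 1)`,
`(e·K₀(64,8)·64)⁻¹`, `A∕4` are OUR numerals over pv22's located letters `κ₀ = 64 log 162`, `K₀(64,8)`, `c₁ = 64`, `ν = 9`; the `5` and the
shape `α₆e^{−δκd}·e^{−R(d+5)}` inside `pF` are N0s's DISPLAYED (2.27)∕(2.28) print-shape, TYPE only — no numeral of [Balaban1988RGII] is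
asserted as a fact about Bałaban's densities; 0 binders instantiated on Bałaban's densities; no wall item; wall v1.7 (T4-DAG v43) does NOT
move; R-t4r2-Q2 NOT met thereby; NE1′ ⇐ the named binders — NOT proved, NOT printed; spine PROVED 0∕9; count 9 unchanged.  Rung (B)+1 on
ONE finite four-torus — NOT infinite volume, NOT a mass gap, NOT OS on ℝ⁴, NOT Clay.  HONEST DEPENDENCY: continuum YM on T⁴ ⇐ BetaPertH ∧
nine spine estimates (0/9 proved); BetaPertH ⇐ (D1) ∧ (D4) ∧ CAP+tail; G-an2-4 gates asym, D1 and NE2/3/4.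
-/

noncomputable section

namespace Summit.QuantumFields.BalabanUV.T4Continuum.NE1p.DressedSmallFieldFamiliesWitness

open Set Metric MeasureTheory Complex
open scoped BigOperators
open Literature.MathematicalPhysics.QuantumFieldTheory.Balaban1983to89
open Literature.MathematicalPhysics.QuantumFieldTheory.Balaban1983to89.B12TreeDecay (K₀ K₀_pos kappa₀_nonneg)
open Literature.MathematicalPhysics.QuantumFieldTheory.Balaban1983to89.B13Resummation (locE)
open Literature.MathematicalPhysics.QuantumFieldTheory.Balaban1983to89.B13FamilySum (coveringFamilies mem_coveringFamilies)
open Literature.MathematicalPhysics.QuantumFieldTheory.Balaban1983to89.TreeLengthTorus (TDom tsys)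
open Literature.MathematicalPhysics.QuantumFieldTheory.Balaban1983to89.TreeLengthTorusGeometry (tgeometry TTouch)
open Summit.QuantumFields.BalabanUV.T4Continuum.B13HistMeasurable (B13HistM)
open Summit.QuantumFields.BalabanUV.T4Continuum.B13HistWitness (toyFrame)
open Summit.QuantumFields.BalabanUV.T4Continuum.B13TermParamGaussianBi (BiCore)
open Summit.QuantumFields.BalabanUV.T4Continuum.NE1p.DressedSmallFieldTorusWitness (X₀ X₀_val eq_X₀_iff hrate_torus
  dressedConst_le_one exp_locE_cube)
open Summit.QuantumFields.BalabanUV.T4Continuum.NE1p.DressedSmallFieldGeometry (torus_consts)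
open Summit.QuantumFields.BalabanUV.T4Continuum.NE1p.DressedSmallFieldGeometryFaces (K₀_four)
open Summit.QuantumFields.BalabanUV.T4Continuum.NE1p.DressedSmallFieldCoresWitness (E1 crd liveTable norm_liveTable_le coreW N₁_coreW
  ctr0 hroom0 Acst Acst_pos incr integral_incr_pos)
open Summit.QuantumFields.BalabanUV.T4Continuum.NE1p.DressedSmallFieldCoresMassWitness (letterMass_coreW cM cM_pos hsmall_mu)
open Summit.QuantumFields.BalabanUV.T4Continuum.NE1p.DressedSmallFieldDepCoresWitness (budget_half dj_X₀ termAt_coreW_pencil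
  closedForm_real_sub_zero norm_term_le)
open Summit.QuantumFields.BalabanUV.T4Continuum.NE1p.DressedSmallFieldFamilyCount (attachedPart_locE_le_of_coresAt_pencil_families)

/-! ## §1 PRINT's ORDER-OF-CHOICE CLAUSES MET at located numerals (OUR numerals over pv22's torus constants) -/

/-- The small rate fraction `δ := 1∕4` (toy numeral; `< 1∕3`, so print's `(1 − 3δ)κ > 0` — not used by the END). [folklore] -/
def δF : ℝ := 1 / 4
/-- The rate `κ := 4·(64·log 162 + 1)` (toy numeral): `δF·κF = κ₀ + 1` at pv22's `κ₀ = 64 log 162`. [folklore] -/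
def κF : ℝ := 4 * (64 * Real.log 162 + 1)
/-- The small constant `α₆ := (e·K₀(64,8)·64)⁻¹` (toy numeral): `e·K₀·c₁·α₆ = 1` at pv22's `K₀ = K₀(64,8)`, `c₁ = 64`. [folklore] -/
def α₆F : ℝ := (Real.exp 1 * K₀ 64 8 * 64)⁻¹

/-- `δF·κF = 64·log 162 + 1`. [arith] -/
theorem δF_mul_κF : δF * κF = 64 * Real.log 162 + 1 := by unfold δF κF; ring
/-- `0 < δF·κF`. [arith] -/
theorem δF_mul_κF_pos : 0 < δF * κF := by
  rw [δF_mul_κF]; have := Real.log_nonneg (by norm_num : (1 : ℝ) ≤ 162); positivity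
/-- `0 < α₆F`. [arith] -/
theorem α₆F_pos : 0 < α₆F := by unfold α₆F; have := K₀_pos (64 : ℝ) 8; positivity
/-- `α₆F ≤ 1`: `e ≥ 2` and `K₀(64,8) = e^{κ₀}∕81 ≥ 1∕81`, so `e·K₀(64,8)·64 ≥ 128∕81 ≥ 1`. [arith] -/
theorem α₆F_le_one : α₆F ≤ 1 := by
  unfold α₆F
  apply inv_le_one_of_one_le₀
  have he : (2 : ℝ) ≤ Real.exp 1 := by have h := Real.add_one_le_exp (1 : ℝ); norm_num at h ⊢; exact h
  have hK : 1 / 81 ≤ K₀ (64 : ℝ) 8 := by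
    unfold K₀
    rw [show (((8 : ℕ) : ℝ) + 1) ^ 2 = 81 by norm_num]
    exact div_le_div_of_nonneg_right (Real.one_le_exp (kappa₀_nonneg (by norm_num) _)) (by norm_num)
  calc (1 : ℝ) ≤ 2 * (1 / 81) * 64 := by norm_num
    _ ≤ Real.exp 1 * K₀ 64 8 * 64 := by gcongr

section Torus
variable (N : ℕ) [NeZero N]

/-- **«κ SUFFICIENTLY LARGE» WITH EQUALITY**: N0s's clause `Gk.κ₀ + 1 ≤ δκ` at `Gk := tgeometry 4 N` (`κ₀ = 64 log 162`, `torus_consts`). [arith] -/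
theorem hκ_F : (tgeometry 4 N).κ₀ + 1 ≤ δF * κF := by rw [δF_mul_κF, (torus_consts N).2.1]
/-- **«α₆ SUFFICIENTLY SMALL» WITH EQUALITY**: `e·Gk.K₀·Gk.c₁·α₆F = 1` (`K₀_four`, `c₁ = 64`). [arith] -/
theorem h229_F_eq : Real.exp 1 * (tgeometry 4 N).K₀ * (tgeometry 4 N).c₁ * α₆F = 1 := by
  rw [K₀_four, (torus_consts N).2.2]; unfold α₆F
  exact mul_inv_cancel₀ (by have := K₀_pos (64 : ℝ) 8; positivity)
/-- … hence N0s's clause `e·Gk.K₀·Gk.c₁·α₆ ≤ 1`. [arith] -/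
theorem h229_F : Real.exp 1 * (tgeometry 4 N).K₀ * (tgeometry 4 N).c₁ * α₆F ≤ 1 := (h229_F_eq N).le

/-! ## §2 LOCATED, IN KERNEL: at a unit cube the 𝐃-sum of (2.29) has exactly ONE family -/

/-- **THE COVERING FAMILIES OF A UNIT CUBE ARE `{{X₀}}`** [decided, kernel]: a family of torus domains (b13's `coveringFamilies`, the index set
of (2.29)) whose footprints unite to the one cube `{0}` consists of non-empty domains inside `{0}` — each IS W24's `X₀` — and is not empty. [folklore] -/
theorem coveringFamilies_unitCube :
    coveringFamilies (Finset.univ : Finset (TDom 4 N)) (tgeometry 4 N).cubes {0} = {{X₀ N}} := by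
  ext Df
  rw [mem_coveringFamilies, Finset.mem_singleton]
  constructor
  · rintro ⟨-, hU⟩
    have hmem : ∀ Z ∈ Df, Z = X₀ N := fun Z hZ =>
      (eq_X₀_iff N Z).1 ((Finset.Nonempty.subset_singleton_iff Z.2.1).1
        (hU ▸ Finset.subset_biUnion_of_mem (tgeometry 4 N).cubes hZ))
    have hne : Df.Nonempty := by
      rw [Finset.nonempty_iff_ne_empty]
      rintro rfl
      rw [Finset.biUnion_empty] at hU
      exact Finset.singleton_ne_empty 0 hU.symm
    obtain ⟨Z, hZ⟩ := hne
    exact Finset.eq_singleton_iff_unique_mem.2 ⟨by rw [← hmem Z hZ]; exact hZ, hmem⟩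
  · rintro rfl
    exact ⟨Finset.subset_univ _, by rw [Finset.singleton_biUnion]; exact X₀_val N⟩

open Classical in
/-- THE TERM INDEXING OF RECORD (toy DATA): the terms of a polymer `Z` are ALL covering families of its footprint in the torus catalogue read
one scale down AT THE SAME SCALE (`foot := id`) — N0s's `hterms` with EQUALITY. [folklore] -/
def termsF (Z : TDom 4 N) : Finset (Finset (TDom 4 N)) :=
  coveringFamilies (Finset.univ : Finset (TDom 4 N)) (tgeometry 4 N).cubes ((tgeometry 4 N).cubes Z)

/-- On `X₀` there is exactly ONE term: the family `{X₀}`. [folklore] -/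
theorem termsF_X₀ : termsF N (X₀ N) = {{X₀ N}} := by
  unfold termsF
  rw [show (tgeometry 4 N).cubes (X₀ N) = {0} from X₀_val N]
  exact coveringFamilies_unitCube N

/-! ## §3 THE FAMILY-INDEXED CORES (toy DATA): one W33 core per covering family, weighted by the (2.28)-shaped product -/

/-- THE PER-FAMILY AMPLITUDE FACTOR (toy DATA): `pF Df := Π_{Y∈Df} (α₆F·e^{−δF κF d(Y)}·e^{−R(d(Y)+5)})`, `R := 2κ₀ + 2` — LITERALLY the
product displayed in N0s §4's `hAmp` at our numerals (print's (2.27)∕(2.28) SHAPE, TYPE only). [folklore] -/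
def pF (Df : Finset (TDom 4 N)) : ℝ :=
  ∏ Y ∈ Df, (α₆F * Real.exp (-(δF * κF * (tsys 4 N).dj Y)) * Real.exp (-((2 * (tgeometry 4 N).κ₀ + 2) * ((tsys 4 N).dj Y + 5))))

/-- `0 < pF Df`. [arith] -/
theorem pF_pos (Df : Finset (TDom 4 N)) : 0 < pF N Df :=
  Finset.prod_pos fun Y _ => by have := α₆F_pos; positivity

/-- `pF Df ≤ 1` (every factor is `≤ 1`: `α₆F ≤ 1`, the rates and tree lengths are `≥ 0`). [arith] -/
theorem pF_le_one (Df : Finset (TDom 4 N)) : pF N Df ≤ 1 := by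
  refine Finset.prod_le_one (fun Y _ => by have := α₆F_pos; positivity) fun Y _ => ?_
  have hd := (tsys 4 N).dj_nonneg Y
  have hκ := (tgeometry 4 N).κ₀_nonneg
  have h1 : Real.exp (-(δF * κF * (tsys 4 N).dj Y)) ≤ 1 :=
    Real.exp_le_one_iff.2 (neg_nonpos.2 (mul_nonneg δF_mul_κF_pos.le hd))
  have h2 : Real.exp (-((2 * (tgeometry 4 N).κ₀ + 2) * ((tsys 4 N).dj Y + 5))) ≤ 1 :=
    Real.exp_le_one_iff.2 (neg_nonpos.2 (by positivity))
  exact mul_le_one₀ (mul_le_one₀ α₆F_le_one (Real.exp_pos _).le h1) (Real.exp_pos _).le h2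

/-- **THE ONE FAMILY ON `X₀` CARRIES `α₆F·e^{−5R}`**: `pF {X₀} = α₆F·e^{−(2κ₀+2)·5}` (`d(X₀) = 0`, W41's `dj_X₀`). [arith] -/
theorem pF_singleton_X₀ : pF N {X₀ N} = α₆F * Real.exp (-((2 * (tgeometry 4 N).κ₀ + 2) * 5)) := by
  unfold pF
  rw [Finset.prod_singleton, dj_X₀, mul_zero, neg_zero, Real.exp_zero, mul_one, zero_add]

variable (r : ℝ) (hr : 0 ≤ r)

/-- THE FAMILY-DEPENDENT CAUCHY WEIGHT (toy DATA): `cF Df := (cM r∕2)·pF Df` (W35's `cM` BY NAME). [folklore] -/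
def cF (Df : Finset (TDom 4 N)) : ℝ := cM r / 2 * pF N Df

/-- `0 < cF Df`. [arith] -/
theorem cF_pos (Df : Finset (TDom 4 N)) : 0 < cF N r Df := mul_pos (half_pos (cM_pos r)) (pF_pos N Df)

/-- **THE FAMILY-INDEXED CORE FAMILY** (toy DATA): at the term `Df` (a Mayer subfamily) W33's one-label core `coreW` (BY NAME) at the weight
`cF Df` — one `BiCore toyFrame (fun _ : Unit => 0) ℂ Unit E1` per `(k, Df, X)`. [folklore] -/
def GF : ∀ (_ : ℕ) (_ : Finset (TDom 4 N)), ℕ → BiCore toyFrame (fun _ : Unit => (0 : ℕ)) ℂ Unit E1 :=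
  fun _ Df _ => coreW (cF N r Df) r hr

/-- The core at `(k, Df, X)`. [folklore] -/
@[simp] theorem GF_apply (k : ℕ) (Df : Finset (TDom 4 N)) (X : ℕ) : GF N r hr k Df X = coreW (cF N r Df) r hr := rfl

/-- THE ACTIVITY OF RECORD (toy DATA): the sum of the family-indexed cores' terms over ALL covering families of the footprint, along the
pencil `s ↦ 0 + s • liveTable` — so N0s's `hact` holds by `rfl` and `hscale` by `rfl` (`emb Z := k`). [folklore] -/
def actF (k : ℕ) (s : ℂ) (Z : TDom 4 N) : ℂ :=
  ∑ Df ∈ termsF N Z, (GF N r hr k Df k).termAt (0 : ℂ) ((0 : B13HistM toyFrame) + s • liveTable)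

/-- **`hAmp` MET FOR EVERY SUB-POLYMER AND EVERY FAMILY** [decided toy], in the LITERAL binder shape of N0s §4 at NE5's toy letters
`(mq, bq, N₀) = (1, 0, 1)`, `ϱ = 2`, `R₀ = ‖0‖ + 2‖liveTable‖`, `A₀ = 0`, `A₁ = A∕4`: the core's letter mass times read-out growth is
`pF Df·|cM r∕2|·√(2π)·e^{r·2‖liveTable‖} ≤ pF Df·A∕2 = (0 + 2·(A∕4))·pF Df` (W35's `letterMass_coreW`, W41's `budget_half` BY NAME). [folklore] -/
theorem hAmp_F (k : ℕ) :
    ∀ Z : (tsys 4 N).Dom, (tgeometry 4 N).cubes Z ⊆ (tgeometry 4 N).cubes (X₀ N) → ∀ Df ∈ termsF N Z,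
      (GF N r hr k Df k).lam.real univ *
          ((GF N r hr k Df k).wB * (fun (_ : ℕ) (_ : Finset (TDom 4 N)) (_ : ℕ) => (1 : ℝ)) k Df k *
            Real.exp ((fun (_ : ℕ) (_ : Finset (TDom 4 N)) (_ : ℕ) => (0 : ℝ)) k Df k)) *
          (Real.pi / ((fun (_ : ℕ) (_ : Finset (TDom 4 N)) (_ : ℕ) => (1 : ℝ)) k Df k / 2)) ^ (Module.finrank ℝ E1 / 2 : ℝ) *
        Real.exp ((GF N r hr k Df k).N₁ * (‖(0 : B13HistM toyFrame)‖ + 2 * ‖liveTable‖)) ≤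
      (0 + 2 * (Acst / 4)) * pF N Df := by
  intro Z _ Df _
  simp only [GF_apply]
  rw [letterMass_coreW, N₁_coreW, norm_zero, zero_add]
  have hp : 0 ≤ pF N Df := (pF_pos N Df).le
  have hT : 2 * ‖liveTable‖ ≤ 2 := by linarith [norm_liveTable_le]
  have hb := budget_half r hr hT
  unfold cF
  rw [abs_mul, abs_of_nonneg hp]
  calc |cM r / 2| * pF N Df * Real.sqrt (2 * Real.pi) * Real.exp (r * (2 * ‖liveTable‖))
      = pF N Df * (|cM r / 2| * Real.sqrt (2 * Real.pi) * Real.exp (r * (2 * ‖liveTable‖))) := by ring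
    _ ≤ pF N Df * (Acst / 2) := mul_le_mul_of_nonneg_left hb hp
    _ = (0 + 2 * (Acst / 4)) * pF N Df := by ring

/-- The «ε small» clause at `A₀ + ϱA₁ = A∕2`: half of W35's `hsmall_mu`. [arith] -/
theorem hsmall_F : (0 + 2 * (Acst / 4)) * Real.exp (0 + 1) * (tgeometry 4 N).K₀ * (tgeometry 4 N).ν * (tgeometry 4 N).c₁ ≤ 1 := by
  have h := hsmall_mu N
  calc (0 + 2 * (Acst / 4)) * Real.exp (0 + 1) * (tgeometry 4 N).K₀ * (tgeometry 4 N).ν * (tgeometry 4 N).c₁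
      = (1 / 2) * (Acst * Real.exp (0 + 1) * (tgeometry 4 N).K₀ * (tgeometry 4 N).ν * (tgeometry 4 N).c₁) := by ring
    _ ≤ (1 / 2) * 1 := by gcongr
    _ ≤ 1 := by norm_num

/-! ## §4 THE END FIRES: N0s §4's families END applied ONCE BY NAME (its first applier) -/

open Classical in
/-- **N0s §4's `attachedPart_locE_le_of_coresAt_pencil_families` FIRES** [decided toy]: step geometry AND scale-`k` geometry the torus
`(tsys 4 N, tgeometry 4 N)` (`foot := id`, `hmono := le_rfl` — the toy reads the scale-`k` catalogue at the step's own scale), cores `GF`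
indexed by covering families, W33's `ctr0`∕`hroom0`, NE5's toy letters INLINE, the pencil's two radius inequalities, `hscale`∕`hact` by
`rfl`, W24's `hrate_torus`, `hsmall_F`, §1's clauses `hκ_F`∕`h229_F`, `hterms` by `Finset.Subset.refl`, `hAmp_F`, `hϱ : 2 ≤ 2`, `hϱA`.
Conclusion LITERAL. [folklore] -/
theorem familiesEnd_fires (k : ℕ) :
    ‖locE (tgeometry 4 N).ι (tgeometry 4 N).cubes (actF N r hr k 1) ((tgeometry 4 N).cubes (X₀ N)) -
        locE (tgeometry 4 N).ι (tgeometry 4 N).cubes (actF N r hr k 0) ((tgeometry 4 N).cubes (X₀ N))‖ ≤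
      4 * (Real.exp 1 * (tgeometry 4 N).ν * (tgeometry 4 N).c₁ * (tgeometry 4 N).K₀ ^ 2) * (Acst / 4) *
        Real.exp (-(0 * (tsys 4 N).dj (X₀ N))) :=
  attachedPart_locE_le_of_coresAt_pencil_families (tsys 4 N) (tgeometry 4 N) (tgeometry 4 N) (GF N r hr)
    (W := Set.univ) (ctr := ctr0) (ROp := fun _ => 1) (RHist := fun _ => 2) (R' := fun _ => 2)
    (mq := fun _ _ _ => 1) (bq := fun _ _ _ => 0) (N₀ := fun _ _ _ => 1)
    hroom0 (fun _ _ _ _ _ _ _ => one_pos)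
    (fun _ _ _ _ _ _ _ => ⟨fun _ _ => aestronglyMeasurable_const, fun _ => differentiableOn_const _, fun _ _ _ => by
      show ‖(1 : ℂ)‖ ≤ 1; rw [norm_one]⟩)
    (fun _ _ _ _ _ _ _ => ⟨fun _ _ => (Complex.measurable_ofReal.comp (measurable_snd.norm.pow_const 2)).aestronglyMeasurable,
      fun _ _ => differentiableOn_const _, fun _ _ _ v => by
        show 1 * ‖v‖ ^ 2 - 0 ≤ (((‖v‖ ^ 2 : ℝ) : ℂ)).re; rw [Complex.ofReal_re]; simp⟩)
    (g := fun _ => 0) (Set.mem_univ _) (U := ()) (o := 0) (h₀ := 0) (w := liveTable) (ϱ := 2)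
    (by show ‖(0 : ℂ) - 0‖ ≤ 1; simp)
    (by show ‖(0 : B13HistM toyFrame) - 0‖ + 2 * ‖liveTable‖ ≤ 2; rw [sub_zero, norm_zero, zero_add];
        linarith [norm_liveTable_le])
    (emb := fun _ => k) (fun _ => rfl) (terms := termsF N) (act := actF N r hr k) (fun _ _ _ => rfl)
    (A₀ := 0) (A₁ := Acst / 4) (R := 2 * (tgeometry 4 N).κ₀ + 2) (r₁ := 0) (b₅ := 0) (X₀ := X₀ N)
    le_rfl (by have := Acst_pos; positivity) le_rfl (by norm_num) (hrate_torus N) (hsmall_F N)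
    (fun Z => Z) (fun _ => le_rfl) (δ := δF) (κ := κF) (α₆ := α₆F) α₆F_pos.le (hκ_F N) (h229_F N)
    (fun _ => Finset.Subset.refl _) (hAmp_F N r hr k) le_rfl (by have := Acst_pos; linarith)

open Classical in
/-- … in CLOSED FORM: `≤ 4·(e·9·64·K₀(64,8)²)·(A∕4) = K₀(64,8)` (pv22's constants by `torus_consts`∕`K₀_four` BY NAME). [folklore] -/
theorem familiesEnd_fires_closed (k : ℕ) :
    ‖locE (tgeometry 4 N).ι (tgeometry 4 N).cubes (actF N r hr k 1) ((tgeometry 4 N).cubes (X₀ N)) -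
        locE (tgeometry 4 N).ι (tgeometry 4 N).cubes (actF N r hr k 0) ((tgeometry 4 N).cubes (X₀ N))‖ ≤ K₀ 64 8 := by
  refine (familiesEnd_fires N r hr k).trans (le_of_eq ?_)
  rw [(torus_consts N).1, (torus_consts N).2.2, K₀_four, zero_mul, neg_zero, Real.exp_zero, mul_one]
  unfold Acst
  have hK := K₀_pos (64 : ℝ) 8
  have he := Real.exp_pos 1
  field_simp

/-! ## §5 GENUINE: on `X₀` the activity is ONE live term, and the END's bounded quantity is NOT zero -/

/-- **THE ACTIVITY AT `X₀` IN CLOSED FORM**: ONE family, ONE core — `actF k s X₀ = cF {X₀}·∫ e^{s·r·e^{−(v 0)²}}·e^{−‖v‖²} dv` (W41's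
`termAt_coreW_pencil` BY NAME). [folklore] -/
theorem actF_X₀ (k : ℕ) (s : ℂ) :
    actF N r hr k s (X₀ N) =
      (cF N r {X₀ N} : ℂ) * ∫ v : E1, cexp (s * ((r : ℂ) * (Real.exp (-(crd v ^ 2)) : ℂ))) * cexp (-(((‖v‖ ^ 2 : ℝ) : ℂ))) := by
  unfold actF
  rw [termsF_X₀, Finset.sum_singleton, GF_apply, termAt_coreW_pencil]

/-- The increment between a REAL source `t` and `0` at `X₀`: `cF {X₀}·∫ incr (t·r)` (W41's `closedForm_real_sub_zero`). [folklore] -/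
theorem actF_real_sub_zero (k : ℕ) (t : ℝ) :
    actF N r hr k (t : ℂ) (X₀ N) - actF N r hr k 0 (X₀ N) = (cF N r {X₀ N} : ℂ) * ((∫ v, incr (t * r) v : ℝ) : ℂ) := by
  rw [actF_X₀, actF_X₀]
  exact closedForm_real_sub_zero _ r hr t

/-- **THE ATTACHED PART OF THE ACTIVITY IS NOT ZERO** (`cF {X₀} > 0`, W33's `∫ incr r > 0` for `0 < r`). [folklore] -/
theorem actF_live (hr0 : 0 < r) (k : ℕ) : actF N r hr k 1 (X₀ N) ≠ actF N r hr k 0 (X₀ N) := by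
  intro h
  have h0 := sub_eq_zero.2 h
  rw [show (1 : ℂ) = ((1 : ℝ) : ℂ) from Complex.ofReal_one.symm, actF_real_sub_zero, one_mul] at h0
  rcases mul_eq_zero.1 h0 with hc | hI
  · exact (cF_pos N r {X₀ N}).ne' (by exact_mod_cast hc)
  · exact (integral_incr_pos r hr0).ne' (by exact_mod_cast hI)

/-- The activities at `X₀` lie STRICTLY inside the unit disc for `‖s‖ ≤ 2` (`pF ≤ 1`, W41's `norm_term_le`, `A ≤ 1`, `√π < √(2π)`). [folklore] -/
theorem norm_actF_X₀_lt_one (k : ℕ) {s : ℂ} (hs : ‖s‖ ≤ 2) : ‖actF N r hr k s (X₀ N)‖ < 1 := by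
  rw [actF_X₀]
  have hp0 := (pF_pos N {X₀ N}).le
  have hp1 := pF_le_one N {X₀ N}
  have hπ : 0 < Real.sqrt Real.pi := Real.sqrt_pos.2 Real.pi_pos
  have hlt : Real.sqrt Real.pi < Real.sqrt (2 * Real.pi) := Real.sqrt_lt_sqrt Real.pi_pos.le (by linarith [Real.pi_pos])
  have hq : Real.sqrt Real.pi / Real.sqrt (2 * Real.pi) < 1 := (div_lt_one (hπ.trans hlt)).2 hlt
  have hA : Acst ≤ 1 := dressedConst_le_one
  have hb := norm_term_le r hr hs
  have hn : ‖(cF N r {X₀ N} : ℂ) * ∫ v : E1, cexp (s * ((r : ℂ) * (Real.exp (-(crd v ^ 2)) : ℂ))) * cexp (-(((‖v‖ ^ 2 : ℝ) : ℂ)))‖ =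
      pF N {X₀ N} * ‖((cM r / 2 : ℝ) : ℂ) * ∫ v : E1, cexp (s * ((r : ℂ) * (Real.exp (-(crd v ^ 2)) : ℂ))) *
        cexp (-(((‖v‖ ^ 2 : ℝ) : ℂ)))‖ := by
    rw [norm_mul, norm_mul, Complex.norm_real, Complex.norm_real, Real.norm_eq_abs, Real.norm_eq_abs]
    unfold cF
    rw [abs_mul, abs_of_nonneg hp0]
    ring
  rw [hn]
  calc pF N {X₀ N} * ‖((cM r / 2 : ℝ) : ℂ) * ∫ v : E1, cexp (s * ((r : ℂ) * (Real.exp (-(crd v ^ 2)) : ℂ))) *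
          cexp (-(((‖v‖ ^ 2 : ℝ) : ℂ)))‖
      ≤ 1 * (Acst / 2 * (Real.sqrt Real.pi / Real.sqrt (2 * Real.pi))) := mul_le_mul hp1 hb (norm_nonneg _) zero_le_one
    _ < 1 := by
        rw [one_mul]
        have := Acst_pos
        nlinarith

open Classical in
/-- **THE END's BOUNDED QUANTITY IS NOT ZERO** [decided toy]: equal dressed outputs on the cube would give equal activities at `X₀` (W24's
`exp_locE_cube` BY NAME), contradicting `actF_live`. [folklore] -/
theorem familiesEnd_live (hr0 : 0 < r) (k : ℕ) :
    locE (tgeometry 4 N).ι (tgeometry 4 N).cubes (actF N r hr k 1) ((tgeometry 4 N).cubes (X₀ N)) ≠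
      locE (tgeometry 4 N).ι (tgeometry 4 N).cubes (actF N r hr k 0) ((tgeometry 4 N).cubes (X₀ N)) := by
  intro h
  have h1 := exp_locE_cube N (w := actF N r hr k 1) (norm_actF_X₀_lt_one N r hr k (by simp))
  have h0 := exp_locE_cube N (w := actF N r hr k 0) (norm_actF_X₀_lt_one N r hr k (by simp))
  have h' : cexp (locE (TTouch (d := 4) (N := N)) (fun Z : (tsys 4 N).Dom => Z.1) (actF N r hr k 1) {0}) =
      cexp (locE (TTouch (d := 4) (N := N)) (fun Z : (tsys 4 N).Dom => Z.1) (actF N r hr k 0) {0}) := congrArg cexp h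
  rw [h1, h0, add_right_inj] at h'
  exact actF_live N r hr hr0 k h'

end Torus

end Summit.QuantumFields.BalabanUV.T4Continuum.NE1p.DressedSmallFieldFamiliesWitness

end
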